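import Summits.ResolutionOfSingularities.ResolutionOfSingularities.Theorems.FrobeniusClosingPatchingRelPerfectDepthMultiHostFormat
import Literature.AlgebraicGeometry.Resolution.RegularCentreBlowupOrder
import HarnessLib

/-!
# Crux `PatchingRelPerfect` (stmt-ResolutionOfSingularities-16161), chain W5.2 — F7(β) (β-AX) X3 C-I: HOST ORDERS DO NOT INCREASE under a
# `MultiHostState.step` at an EQUIMULTIPLE centre (the (n2) lemma of res-L1-w52-plan-1 NAMING G12-14 — PRESEARCH HIT: it is the tree's
# Cossart–Piltant Prop. 4.2 (a), `IsBlowup.idealOrder_controlledTransform_le_of_mem`, read on the multi-host format)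

[OURS · L1 W5.2 · F7(β) (β-AX) X3 · NAMING G12-14 (hand res-D-pv-021 g9).]  Replaces the role of NO printed item; NOT a statement of the
manuscript under review; fact-free.  AI-written; AI review is weaker than expert review.  No definitions.

PRESEARCH (G12-14 «rg the two W43 files before writing»): the W43 files `WeightedInvariantOrderNonIncrease(Partial)` are the COBORDANT
(weighted, `extReesAlgebra`) form; the ORDINARY-blow-up statement named in G12-14 — «S regular local, p prime with S/p regular, h ∈ p^m of
order m ⇒ in every chart of Bl_p S at every point over the closed point the controlled transform h/t^m has order ≤ m» — IS ALREADY IN THE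
TREE, both ring-level (`Literature/…/RegularCentreBlowupOrder.lean`: `exists_chartResidueMap`, `map_residue_ne_zero_of_eval_not_mem_pow_succ`,
`eval₂Hom_chartGen_not_mem_maximalIdeal_pow_of_le` = Cossart–Piltant (10)–(11)) and scheme-level
(`IsBlowup.idealOrder_controlledTransform_le_of_mem` / `_of_forall`, and `idealOrder_controlledTransform_le_of_isRegular` in
`Hironaka2005BasicFactsRegularEquiv.lean`).  Nothing is re-proved here; this file only READS it on `MultiHostState.step` (p540590), whose
hosts transform by `step_host : (S.step …).host i = controlledTransform τ 𝓘_W (S.host i) (m i)`: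

* **`MultiHostState.idealOrder_step_host_le_of_mem`** — if host `i` is EQUIMULTIPLE of order `m i` along the centre `W`
  (`∀ y ∈ W, ord_y (host i) = m i`; for the (β-AX) chain this is stub-1΄s (EQ) `mOrder_eq_mOrder_localization_of_isPermissible` read on the
  host trace), then at every point `x′` of the new exceptional member `ord_{x′} (host′ i) ≤ m i`.
* `MultiHostState.idealOrder_step_host_le` — with `ord (host i) ≤ m i` everywhere on `X` as well, `ord (host′ i) ≤ m i` everywhere on `X′`
  («(EQ)-monotone host orders along the chain», tri-1; stub-2΄s (M0) part 2; lead-1΄s pole chart).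

## References
* V. Cossart, O. Piltant, *Resolution of singularities of threefolds in positive characteristic I*, J. Algebra 320 (2008), proof of
  Prop. 4.2 (a), (10)–(11). [CossartPiltant2008]
* J. Kollár, *Lectures on Resolution of Singularities* (2007), (3.111) Step 1. [Kollar2007]
-/

-- `Summit.<Summit>.<Sub>.Theorems` with `Sub = Summit` (single-conjunct summit, D-0017)
set_option linter.dupNamespace false

noncomputable section

open CategoryTheory AlgebraicGeometry TopologicalSpace
open Literature.AlgebraicGeometry.Resolution
open Literature.AlgebraicGeometry.Hironaka2017.MonomialPart
open Scheme.IdealSheafData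

namespace Summit.ResolutionOfSingularities.ResolutionOfSingularities.Theorems.DepthMultiHost.MultiHostState

universe u

variable {X X' : Scheme.{u}} [IsLocallyNoetherian X] (S : MultiHostState X) (τ : X' ⟶ X) (W : Closeds X) (η : X)
  (m : Fin S.n → ℕ) (ν : ℕ) (hsnc : HasSNCWith S.𝓔 (vanishingIdeal W)) (hτ : IsBlowup τ (vanishingIdeal W))

/-- **Host orders do not increase over an equimultiple centre** (Cossart–Piltant Prop. 4.2 (a) on the multi-host format): `X` regular,
`W` a regular centre along which host `i` is equimultiple of order `m i`; then at every point `x′` of `X′ = Bl_W X` over `W` the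
transformed host `host′ i = τᶜ(host i, m i)` has `ord_{x′} ≤ m i`. [cite: CossartPiltant2008, proof of Prop. 4.2 (a)] -/
theorem idealOrder_step_host_le_of_mem (hX : Scheme.IsRegular X) (hW : Scheme.IsRegular (vanishingIdeal W).subscheme)
    (i : Fin S.n) (hm : ∀ y ∈ (W : Set X), idealOrder (S.host i) y = m i) {x' : X'} (hx' : τ x' ∈ (W : Set X)) :
    idealOrder ((S.step τ W η m ν hsnc hτ).host i) x' ≤ m i := by
  haveI : IsProper τ := hτ.isProper
  haveI : IsLocallyNoetherian X' := LocallyOfFiniteType.isLocallyNoetherian τ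
  rw [step_host]
  exact hτ.idealOrder_controlledTransform_le_of_mem hX hW hm hx'

/-- **Host orders do not increase, everywhere**: if moreover `ord (host i) ≤ m i` at every point of `X`, then `ord (host′ i) ≤ m i` at every
point of `X′` (off the exceptional member nothing changes). [cite: CossartPiltant2008, proof of Prop. 4.2 (a)] -/
theorem idealOrder_step_host_le (hX : Scheme.IsRegular X) (hW : Scheme.IsRegular (vanishingIdeal W).subscheme) (i : Fin S.n)
    (hm : ∀ y ∈ (W : Set X), idealOrder (S.host i) y = m i) (hle : ∀ x : X, idealOrder (S.host i) x ≤ m i) (x' : X') :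
    idealOrder ((S.step τ W η m ν hsnc hτ).host i) x' ≤ m i := by
  haveI : IsProper τ := hτ.isProper
  haveI : IsLocallyNoetherian X' := LocallyOfFiniteType.isLocallyNoetherian τ
  rw [step_host]
  exact hτ.idealOrder_controlledTransform_le_of_forall hX hW hm hle x'

end Summit.ResolutionOfSingularities.ResolutionOfSingularities.Theorems.DepthMultiHost.MultiHostState

end
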